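import Literature.Probability.Percolation.DKTLemma6Translates
import Literature.Probability.Percolation.CerfUniquenessZoneBound
import Literature.Probability.Percolation.CorrelationLengthDKTAssembly
import Literature.Probability.Percolation.CorrelationLengthDKTProp1
import Mathlib.Analysis.SpecialFunctions.Pow.Asymptotics
import Mathlib.Analysis.SpecialFunctions.Log.Basic
import HarnessLib

/-!
# DKT 2020: Lemma 6 for bond percolation, Proposition 5, and Theorem 2 (subcritical) discharged

Topic `Literature/Probability/Percolation`. Duminil-Copin–Kozma–Tassion, *Upper bounds on the
percolation correlation length* (arXiv:1902.03207; in *In and Out of Equilibrium 3*, Progr.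
Probab. 77, 2021), §4 and Theorem 2:

* **Lemma 6** (`DKT20.lemma6`): for `p ∈ [δ, 1−δ]`, `0 < β < α` and `n` large, every edge `e`
  inside `Λ_n` satisfies `P_p(e pivotal for armEvent ⌊n^β⌋ n) ≤ n^{−β/16}`. Printed proof: far
  from `Λ_m ∪ ∂Λ_n` the two-arms event of the edge occurs (bounded here by the
  Aizenman–Kesten–Newman bound `AKN.exists_real_edgeTwoArms_le`, any polynomial decay sufficing);
  near `Λ_m` or `∂Λ_n` the sliding argument over `I ≍ m^{3/4}` translates with the second-moment
  bound (32)–(34) (`DKTLemma6Translates.lean`) and Proposition 1 (`AKN.dkt_prop1`) for the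
  pairwise intersections (geometry in `DKTLemma6Geometry.lean`).
* **Proposition 5** for every `β ∈ (0,1)` (`DKT20.prop5`): for `β < α` from Lemma 6 through
  `DKT20.prop5_of_lemma6` (`CorrelationLengthDKTProp5.lean`), for `β ≥ α` by monotonicity in `β`
  ("we may assume without loss of generality that `β < α`").
* `DuminilcopinKozmaTassion2020_thm2_subcritical_holds` — **Theorem 2 for `p < p_c`**
  (`ξ_p ≤ exp(C/(p_c − p)²)`, `d ≥ 3`), the discharge of the named fact
  `DuminilcopinKozmaTassion2020_thm2_subcritical` (`CorrelationLengthDKT.lean`), via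
  `DKT20.thm2_subcritical_of_prop5` (Theorem 7 + Propositions 4, 1 and the §6 reduction).

## References

* H. Duminil-Copin, G. Kozma, V. Tassion, arXiv:1902.03207, Lemma 6, Prop. 5, Thm. 2
  [DuminilcopinKozmaTassion2020].
* M. Aizenman, H. Kesten, C. M. Newman, Comm. Math. Phys. 111 (1987) [AizenmanKestenNewman1987].
* R. Cerf, Ann. Probab. 43 (2015) [Cerf2015].
-/

noncomputable section

namespace Literature.Probability.Percolation

namespace DKT20

open _root_.MeasureTheory LatticeModels Finset GM Filter Asymptotics
open scoped Classical

variable {d : ℕ}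

/-! ## The translation vectors -/

/-- The inward sliding vector: `s` towards the origin in every coordinate.
[cite: DuminilcopinKozmaTassion2020, Lemma 6 (proof: "a translation τ by a vector in Λ_{m^{1/4}}")] -/
def zIn (c : Site d) (s : ℕ) : Site d := fun j => if 0 ≤ c j then (s : ℤ) else -(s : ℤ)

/-- The outward sliding vector along the coordinate `j₁`. [cite: DuminilcopinKozmaTassion2020, Lemma 6 (proof, case near ∂Λ_n)] -/
def zOut (c : Site d) (s : ℕ) (j₁ : Fin d) : Site d := Pi.single j₁ (if 0 ≤ c j₁ then -(s : ℤ) else (s : ℤ))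

/-- Coordinates of a multiple of `zIn`. [folklore] -/
theorem smul_zIn_bounds (c : Site d) (s k : ℕ) (j : Fin d) :
    -((k : ℤ) * s) ≤ ((k : ℤ) • zIn c s) j ∧ ((k : ℤ) • zIn c s) j ≤ (k : ℤ) * s := by
  have h0 : (0 : ℤ) ≤ (k : ℤ) * s := by positivity
  simp only [Pi.smul_apply, zIn, smul_eq_mul]
  split_ifs
  · constructor <;> linarith
  · constructor <;> linarith [mul_neg (k : ℤ) (s : ℤ)]

/-- Coordinates of a multiple of `zOut`. [folklore] -/
theorem smul_zOut_bounds (c : Site d) (s k : ℕ) (j₁ j : Fin d) :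
    -((k : ℤ) * s) ≤ ((k : ℤ) • zOut c s j₁) j ∧ ((k : ℤ) • zOut c s j₁) j ≤ (k : ℤ) * s := by
  have h0 : (0 : ℤ) ≤ (k : ℤ) * s := by positivity
  simp only [Pi.smul_apply, zOut, smul_eq_mul]
  by_cases hj : j = j₁
  · subst hj; simp only [Pi.single_eq_same]
    split_ifs
    · constructor <;> linarith [mul_neg (k : ℤ) (s : ℤ)]
    · constructor <;> linarith
  · rw [Pi.single_eq_of_ne hj]; simp [h0]

/-- **Inner sliding keeps the edge inside the small box**: for `c ∈ Λ_{m+s−1}`, a vertex `t` with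
`c ≤ t ≤ c + 1` coordinatewise, and `1 ≤ k`, `k s ≤ m`: `t − k·zIn ∈ Λ_m`.
[cite: DuminilcopinKozmaTassion2020, Lemma 6 (proof: "e ∈ τ^i Λ_m for every i ≤ I")] -/
theorem sub_smul_zIn_mem_box {c t : Site d} {m s k : ℕ} (hc : c ∈ box d (m + s - 1)) (hs : 1 ≤ s)
    (ht : ∀ j, c j ≤ t j ∧ t j ≤ c j + 1) (hk : 1 ≤ k) (hks : k * s ≤ m) :
    t - (k : ℤ) • zIn c s ∈ box d m := by
  rw [mem_box]; intro j
  have hcj := (mem_box (x := c)).1 hc j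
  have hks' : (s : ℤ) ≤ (k : ℤ) * s := by exact_mod_cast (Nat.le_mul_of_pos_left s hk)
  have hksm : (k : ℤ) * s ≤ m := by exact_mod_cast hks
  have hms : ((m + s - 1 : ℕ) : ℤ) = m + s - 1 := by
    rw [Nat.cast_sub (by omega)]; push_cast; ring
  rw [hms] at hcj
  obtain ⟨ht1, ht2⟩ := ht j
  simp only [Pi.sub_apply, Pi.smul_apply, zIn, smul_eq_mul]
  split_ifs with h
  · constructor <;> nlinarith
  · push Not at h
    constructor <;> nlinarith

/-- **Outer sliding moves the edge outside the big box**: if `|c_{j₁}| ≥ n − r`, `s = r + 3`,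
`|t_{j₁} − c_{j₁}| ≤ 1` and `k ≥ 1`, then `t − k·zOut ∉ Λ_n`.
[cite: DuminilcopinKozmaTassion2020, Lemma 6 (proof: "e_i does not belong to τ^j Λ_n")] -/
theorem sub_smul_zOut_notMem_box {c t : Site d} {n r k : ℕ} {j₁ : Fin d} (hc : (n : ℤ) - r ≤ |c j₁|)
    (ht : c j₁ - 1 ≤ t j₁ ∧ t j₁ ≤ c j₁ + 1) (hk : 1 ≤ k) :
    t - (k : ℤ) • zOut c (r + 3) j₁ ∉ box d n := by
  rw [mem_box]; intro h
  have hj := h j₁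
  simp only [Pi.sub_apply, Pi.smul_apply, zOut, Pi.single_eq_same, smul_eq_mul] at hj
  have hks' : ((r + 3 : ℕ) : ℤ) ≤ (k : ℤ) * ((r + 3 : ℕ) : ℤ) := by exact_mod_cast (Nat.le_mul_of_pos_left _ hk)
  push_cast at hks' hj
  split_ifs at hj with h0
  · rw [abs_of_nonneg h0] at hc; nlinarith
  · push Not at h0; rw [abs_of_neg h0] at hc; nlinarith

/-- Outer sliding keeps the edge outside `Λ_N` (for `N + m + r + 1 < n`, `k s ≤ m`).
[cite: DuminilcopinKozmaTassion2020, Lemma 6 (proof)] -/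
theorem add_smul_zOut_notMem_box {c t : Site d} {n r m N k : ℕ} {j₁ : Fin d} (hc : (n : ℤ) - r ≤ |c j₁|)
    (ht : c j₁ - 1 ≤ t j₁ ∧ t j₁ ≤ c j₁ + 1) (hks : k * (r + 3) ≤ m) (hN : N + m + r + 1 < n) :
    t + (k : ℤ) • zOut c (r + 3) j₁ ∉ box d N := by
  rw [mem_box]; intro h
  have hj := h j₁
  simp only [Pi.add_apply, Pi.smul_apply, zOut, Pi.single_eq_same, smul_eq_mul] at hj
  have hks' : (k : ℤ) * ((r + 3 : ℕ) : ℤ) ≤ m := by exact_mod_cast hks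
  have hN' : (N : ℤ) + m + r + 1 < n := by exact_mod_cast hN
  push_cast at hks' hj
  have hk0 : (0 : ℤ) ≤ k := by positivity
  split_ifs at hj with h0
  · rw [abs_of_nonneg h0] at hc; nlinarith
  · push Not at h0; rw [abs_of_neg h0] at hc; nlinarith

/-- A small translate of the big box contains `Λ_{N+1}`: if `|v|_∞ ≤ m` and `N + 1 + m ≤ n` then
`Λ_{N+1} ⊆ v + Λ_n`. [folklore] -/
theorem box_succ_subset_ball {v : Site d} {m n N : ℕ} (hv : ∀ j, -(m : ℤ) ≤ v j ∧ v j ≤ m) (hN : N + 1 + m ≤ n) :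
    box d (N + 1) ⊆ ball v n := by
  intro y hy
  rw [mem_ball]; rw [mem_box] at hy
  intro j
  have h1 := hy j; have h2 := hv j
  have h3 : ((N + 1 : ℕ) : ℤ) + m ≤ n := by exact_mod_cast hN
  push_cast at h1 h3
  constructor <;> linarith

/-- A small translate of the small box lies in `Λ_K`: if `|v|_∞ ≤ m` and `2m ≤ K` then
`v + Λ_m ⊆ Λ_K`. [folklore] -/
theorem ball_subset_box {v : Site d} {m K : ℕ} (hv : ∀ j, -(m : ℤ) ≤ v j ∧ v j ≤ m) (hK : 2 * m ≤ K) : ball v m ⊆ box d K := by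
  intro y hy
  rw [mem_ball] at hy; rw [mem_box]
  intro j
  have h1 := hy j; have h2 := hv j
  have h3 : (2 : ℤ) * m ≤ K := by exact_mod_cast hK
  constructor <;> linarith

/-- A vertex of sup-norm `≤ m + s` translated by `|v|_∞ ≤ m` lies in `Λ_{2m+s}`. [folklore] -/
theorem add_mem_box {t v : Site d} {m s : ℕ} (ht : ∀ j, -((m : ℤ) + s) ≤ t j ∧ t j ≤ m + s) (hv : ∀ j, -(m : ℤ) ≤ v j ∧ v j ≤ m) :
    t + v ∈ box d (2 * m + s) := by
  rw [mem_box]; intro j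
  have h1 := ht j; have h2 := hv j
  simp only [Pi.add_apply]
  push_cast
  constructor <;> linarith

/-! ## Measurability of pivotality for the translated arm events -/

/-- `armEventAt` is measurable. [folklore] -/
theorem measurableSet_armEventAt (v : Site d) (m n : ℕ) : MeasurableSet (armEventAt v m n) := by
  rw [armEventAt_eq_preimage]
  exact (BondConfig.relabel _).measurable (measurableSet_armEvent m n)

/-- The pivotality event of a measurable event is measurable. [folklore] -/
theorem measurableSet_isPivotal {V : Type*} {A : Set (BondConfig V)} (hA : MeasurableSet A) (e : Sym2 V) :
    MeasurableSet {ω : BondConfig V | IsPivotal A e ω} := by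
  have h1 : MeasurableSet {ω : BondConfig V | insert e ω ∈ A} := (AKN.measurable_insert e) hA
  have h2 : MeasurableSet {ω : BondConfig V | ω \ {e} ∈ A} := (AKN.measurable_diff_singleton e) hA
  have : {ω : BondConfig V | IsPivotal A e ω} = ({ω | insert e ω ∈ A} ∩ {ω | ω \ {e} ∈ A}ᶜ) ∪ ({ω | ω \ {e} ∈ A} ∩ {ω | insert e ω ∈ A}ᶜ) := by
    ext ω; simp only [IsPivotal, Set.mem_setOf_eq, Set.mem_union, Set.mem_inter_iff, Set.mem_compl_iff]; exact Iff.rfl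
  rw [this]
  exact (h1.inter h2.compl).union (h2.inter h1.compl)

/-- The closed-pivotal event of `armEventAt` is measurable. [folklore] -/
theorem measurableSet_closedPivotal_armEventAt (v : Site d) (m n : ℕ) (e : Sym2 (Site d)) :
    MeasurableSet {ω : BondConfig (Site d) | e ∉ ω ∧ IsPivotal (armEventAt v m n) e ω} :=
  (measurableSet_mem e).compl.inter (measurableSet_isPivotal (measurableSet_armEventAt v m n) e)

/-! ## The far case bound -/

/-- **Far case**: `P_p(e closed pivotal) ≤ P_p(edgeTwoArms i r)` when the ball of radius `r` around
`e = {c, c+eᵢ}` lies in `Λ_{n'}` (`n = n'+1`) and misses `Λ_m`.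
[cite: DuminilcopinKozmaTassion2020, Lemma 6 (proof, case ρ ≥ m^{1/4})] -/
theorem real_closedPivotal_far_le (p : unitInterval) {m n' r : ℕ} {c : Site d} {i : Fin d} (hr : 1 ≤ r)
    (hball : ball c r ⊆ box d n') (hdisj : Disjoint (ball c r) (box d m)) :
    (bondPercolation (zdGraph d) p).real {ω | s(c, c + Pi.single i 1) ∉ ω ∧ IsPivotal (armEvent m (n' + 1)) s(c, c + Pi.single i 1) ω} ≤
      (bondPercolation (zdGraph d) p).real (AKN.edgeTwoArms i r) := by
  rw [← AKN.real_edgeTwoArmsAt p c i r]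
  exact measureReal_mono (closedPivotal_far_subset hr hball hdisj)

/-! ## The near cases: the sliding bound -/

/-- Bounds on the coordinates of `c` and `c + eᵢ` for `c ∈ Λ_{m+s−1}`. [folklore] -/
theorem endpoint_bounds {c : Site d} {m s : ℕ} (hc : c ∈ box d (m + s - 1)) (hs : 1 ≤ s) {t : Site d}
    (ht : ∀ j, c j ≤ t j ∧ t j ≤ c j + 1) : ∀ j, -((m : ℤ) + s) ≤ t j ∧ t j ≤ m + s := by
  intro j
  have hcj := (mem_box (x := c)).1 hc j
  have hms : ((m + s - 1 : ℕ) : ℤ) = m + s - 1 := by rw [Nat.cast_sub (by omega)]; push_cast; ring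
  rw [hms] at hcj
  obtain ⟨h1, h2⟩ := ht j
  constructor <;> linarith [hcj.1, hcj.2]

/-- The two endpoints `t ∈ {c, c + eᵢ}` satisfy `c ≤ t ≤ c + 1` coordinatewise. [folklore] -/
theorem endpoint_coord (c : Site d) (i : Fin d) :
    (∀ j, c j ≤ c j ∧ c j ≤ c j + 1) ∧ (∀ j, c j ≤ (c + Pi.single i 1 : Site d) j ∧ (c + Pi.single i 1 : Site d) j ≤ c j + 1) := by
  refine ⟨fun j => ⟨le_rfl, by linarith⟩, fun j => ?_⟩
  by_cases hji : j = i
  · subst hji; simp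
  · simp [hji]

/-- **The sliding bound, abstract form**: given a vector `z` with `|k·z|_∞ ≤ k s`, `I ≥ 1` translates
with `I s ≤ m`, `N + 1 + m ≤ n`, and the pairwise inclusion of closed-pivotal intersections in
`twoCross K N`, the closed-pivotal probability is at most `√(1/I + P_p(twoCross K N))`.
[cite: DuminilcopinKozmaTassion2020, Lemma 6 (proof, (32)-(34))] -/
theorem real_closedPivotal_le_sqrt_of_pairs (p : unitInterval) {m n N K I : ℕ} (hI : 1 ≤ I) (x y z : Site d)
    (hpair : ∀ k < I, ∀ l < I, k < l →
      {ω | s(x + (k : ℤ) • z, y + (k : ℤ) • z) ∉ ω ∧ IsPivotal (armEventAt ((k : ℤ) • z) m n) s(x + (k : ℤ) • z, y + (k : ℤ) • z) ω} ∩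
        {ω | s(x + (l : ℤ) • z, y + (l : ℤ) • z) ∉ ω ∧ IsPivotal (armEventAt ((l : ℤ) • z) m n) s(x + (l : ℤ) • z, y + (l : ℤ) • z) ω} ⊆
        twoCross (d := d) K N) :
    (bondPercolation (zdGraph d) p).real {ω | s(x, y) ∉ ω ∧ IsPivotal (armEvent (d := d) m n) s(x, y) ω} ≤
      Real.sqrt (1 / I + (bondPercolation (zdGraph d) p).real (twoCross (d := d) K N)) := by
  set B : ℕ → Set (BondConfig (Site d)) := fun k =>
    {ω | s(x + (k : ℤ) • z, y + (k : ℤ) • z) ∉ ω ∧ IsPivotal (armEventAt ((k : ℤ) • z) m n) s(x + (k : ℤ) • z, y + (k : ℤ) • z) ω} with hB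
  refine closedPivotal_le_sqrt (bondPercolation (zdGraph d) p) hI (B := B)
    (fun k _ => measurableSet_closedPivotal_armEventAt _ m n _) measureReal_nonneg (fun k _ => ?_) (fun k hk l hl hkl => ?_)
  · exact real_closedPivotal_translate p ((k : ℤ) • z) m n x y
  · rcases lt_or_gt_of_ne hkl with h | h
    · exact measureReal_mono (hpair k hk l hl h)
    · rw [Set.inter_comm]; exact measureReal_mono (hpair l hl k hk h)

/-- `l•z − k•z = (l − k)•z` with natural scalars, `k ≤ l`. [folklore] -/
theorem sub_smul_eq {z : Site d} {k l : ℕ} (hkl : k ≤ l) (t : Site d) :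
    t + (k : ℤ) • z - (l : ℤ) • z = t - ((l - k : ℕ) : ℤ) • z := by
  rw [Nat.cast_sub hkl, sub_smul]; abel

/-- Membership in a ball via the difference. [folklore] -/
theorem mem_ball_iff_sub_mem_box {v y : Site d} {m : ℕ} : y ∈ ball v m ↔ y - v ∈ box d m := by
  rw [mem_ball, mem_box]; rfl

/-- **Near-inner case bound.** [cite: DuminilcopinKozmaTassion2020, Lemma 6 (proof, case near Λ_m)] -/
theorem real_closedPivotal_inner_le (p : unitInterval) {m n r N I : ℕ} {c : Site d} {i : Fin d}
    (hc : c ∈ box d (m + (r + 3) - 1)) (hI : 1 ≤ I) (hIs : I * (r + 3) ≤ m) (hNn : N + 1 + m ≤ n)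
    (hKN : 2 * m + (r + 3) ≤ N) :
    (bondPercolation (zdGraph d) p).real {ω | s(c, c + Pi.single i 1) ∉ ω ∧ IsPivotal (armEvent m n) s(c, c + Pi.single i 1) ω} ≤
      Real.sqrt (1 / I + (bondPercolation (zdGraph d) p).real (twoCross (d := d) (2 * m + (r + 3)) N)) := by
  have hs : 1 ≤ r + 3 := by omega
  refine real_closedPivotal_le_sqrt_of_pairs p hI c (c + Pi.single i 1) (zIn c (r + 3)) fun k hk l hl hkl => ?_
  -- bounds on `k•z`, `l•z`
  have hkz : ∀ k' : ℕ, k' < I → ∀ j, -(m : ℤ) ≤ ((k' : ℤ) • zIn c (r + 3)) j ∧ ((k' : ℤ) • zIn c (r + 3)) j ≤ m := by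
    intro k' hk' j
    have hb := smul_zIn_bounds c (r + 3) k' j
    have : (k' : ℤ) * ((r + 3 : ℕ) : ℤ) ≤ m := by
      have : k' * (r + 3) ≤ m := (Nat.mul_le_mul_right _ hk'.le).trans hIs
      exact_mod_cast this
    constructor <;> linarith [hb.1, hb.2]
  obtain ⟨hcc, hce⟩ := endpoint_coord c i
  have htc := endpoint_bounds hc hs hcc
  have hte := endpoint_bounds hc hs hce
  refine closedPivotal_inter_subset_twoCross_inner (box_succ_subset_ball (hkz k hk) hNn) (box_succ_subset_ball (hkz l hl) hNn)
    ⟨?_, ?_⟩ ⟨add_mem_box htc (hkz k hk), add_mem_box hte (hkz k hk)⟩ ⟨add_mem_box htc (hkz l hl), add_mem_box hte (hkz l hl)⟩ hKN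
  · rw [mem_ball_iff_sub_mem_box, sub_smul_eq hkl.le]
    exact sub_smul_zIn_mem_box hc hs hcc (by omega) ((Nat.mul_le_mul_right _ (by omega : l - k ≤ I)).trans hIs)
  · rw [mem_ball_iff_sub_mem_box, sub_smul_eq hkl.le]
    exact sub_smul_zIn_mem_box hc hs hce (by omega) ((Nat.mul_le_mul_right _ (by omega : l - k ≤ I)).trans hIs)

/-- **Near-outer case bound.** [cite: DuminilcopinKozmaTassion2020, Lemma 6 (proof, case near ∂Λ_n)] -/
theorem real_closedPivotal_outer_le (p : unitInterval) {m n r N I : ℕ} {c : Site d} {i j₁ : Fin d}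
    (hc : (n : ℤ) - r ≤ |c j₁|) (hI : 1 ≤ I) (hIs : I * (r + 3) ≤ m) (hNn : N + m + r + 1 < n)
    (hKN : 2 * m + (r + 3) ≤ N) :
    (bondPercolation (zdGraph d) p).real {ω | s(c, c + Pi.single i 1) ∉ ω ∧ IsPivotal (armEvent m n) s(c, c + Pi.single i 1) ω} ≤
      Real.sqrt (1 / I + (bondPercolation (zdGraph d) p).real (twoCross (d := d) (2 * m + (r + 3)) N)) := by
  refine real_closedPivotal_le_sqrt_of_pairs p hI c (c + Pi.single i 1) (zOut c (r + 3) j₁) fun k hk l hl hkl => ?_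
  have hkz : ∀ k' : ℕ, k' < I → ∀ j, -(m : ℤ) ≤ ((k' : ℤ) • zOut c (r + 3) j₁) j ∧ ((k' : ℤ) • zOut c (r + 3) j₁) j ≤ m := by
    intro k' hk' j
    have hb := smul_zOut_bounds c (r + 3) k' j₁ j
    have : (k' : ℤ) * ((r + 3 : ℕ) : ℤ) ≤ m := by
      have : k' * (r + 3) ≤ m := (Nat.mul_le_mul_right _ hk'.le).trans hIs
      exact_mod_cast this
    constructor <;> linarith [hb.1, hb.2]
  have hks : ∀ k' : ℕ, k' < I → k' * (r + 3) ≤ m := fun k' hk' => (Nat.mul_le_mul_right _ hk'.le).trans hIs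
  have htc : c j₁ - 1 ≤ c j₁ ∧ c j₁ ≤ c j₁ + 1 := ⟨by linarith, by linarith⟩
  have hte : c j₁ - 1 ≤ (c + Pi.single i 1 : Site d) j₁ ∧ (c + Pi.single i 1 : Site d) j₁ ≤ c j₁ + 1 := by
    by_cases hji : j₁ = i
    · subst hji; simp; linarith
    · simp [hji]
  have hNn' : N + 1 + m ≤ n := by omega
  have h2m : 2 * m ≤ 2 * m + (r + 3) := by omega
  refine closedPivotal_inter_subset_twoCross_outer (box_succ_subset_ball (hkz l hl) hNn') ⟨?_, ?_⟩
    ⟨add_smul_zOut_notMem_box hc htc (hks k hk) hNn, add_smul_zOut_notMem_box hc hte (hks k hk) hNn⟩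
    ⟨add_smul_zOut_notMem_box hc htc (hks l hl) hNn, add_smul_zOut_notMem_box hc hte (hks l hl) hNn⟩
    (ball_subset_box (hkz k hk) h2m) (ball_subset_box (hkz l hl) h2m) hKN
  · rw [mem_ball_iff_sub_mem_box, sub_smul_eq hkl.le]
    exact sub_smul_zOut_notMem_box hc htc (by omega)
  · rw [mem_ball_iff_sub_mem_box, sub_smul_eq hkl.le]
    exact sub_smul_zOut_notMem_box hc hte (by omega)

/-! ## Lemma 6 at a fixed scale -/

/-- Every edge inside `Λ_n` is `{c, c + eᵢ}` with `c ∈ Λ_n`. [folklore] -/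
theorem exists_eq_mk_of_mem_edgesIn {n : ℕ} {e : Sym2 (Site d)} (he : e ∈ edgesIn (zdGraph d) (box d n)) :
    ∃ c : Site d, ∃ i : Fin d, c ∈ box d n ∧ e = s(c, c + Pi.single i 1) := by
  induction e using Sym2.ind with
  | h u v =>
    obtain ⟨hadj, hmem⟩ := mem_edgesIn_iff.1 he
    have hu : u ∈ box d n := hmem u (Sym2.mem_mk_left u v)
    have hv : v ∈ box d n := hmem v (Sym2.mem_mk_right u v)
    obtain ⟨i, h | h⟩ := (zdGraph_adj_iff u v).1 hadj
    · exact ⟨u, i, hu, by rw [h]⟩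
    · exact ⟨v, i, hv, by rw [h, Sym2.eq_swap]⟩

/-- **The far-case hypotheses from the complement of the near cases**: if `c ∉ Λ_{m+r+2}` and
`|c_j| < n' + 1 − r` for all `j`, then `c + Λ_r ⊆ Λ_{n'}` and `c + Λ_r` misses `Λ_m`. [folklore] -/
theorem far_of_not_near {m n' r : ℕ} {c : Site d} (h1 : c ∉ box d (m + (r + 3) - 1))
    (h2 : ∀ j, |c j| < (n' + 1 : ℕ) - r) : ball c r ⊆ box d n' ∧ Disjoint (ball c r) (box d m) := by
  constructor
  · intro y hy
    rw [mem_ball] at hy; rw [mem_box]; intro j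
    have hyj := hy j; have hcj := h2 j
    rw [abs_lt] at hcj; push_cast at hcj
    constructor <;> linarith [hyj.1, hyj.2, hcj.1, hcj.2]
  · rw [Finset.disjoint_left]
    intro y hy hym
    apply h1
    rw [mem_ball] at hy; rw [mem_box] at hym ⊢
    intro j
    have hyj := hy j; have hmj := hym j
    have hms : ((m + (r + 3) - 1 : ℕ) : ℤ) = m + r + 2 := by rw [Nat.cast_sub (by omega)]; push_cast; ring
    rw [hms]
    constructor <;> linarith [hyj.1, hyj.2, hmj.1, hmj.2]

/-- **Lemma 6 at a fixed scale** (all three cases): with `s = r + 3`, `I = m / s ≥ 1`, `N + m + r + 1 < n`,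
`2m + s ≤ N`, for `p < 1` and every edge `e` inside `Λ_n`,
`(1 − p) P_p(e pivotal for armEvent m n) ≤ max( P_p(edgeTwoArms · r), √(1/I + P_p(twoCross (2m+s) N)) )`.
[cite: DuminilcopinKozmaTassion2020, Lemma 6 (proof)] -/
theorem lemma6_at (p : unitInterval) {m n r N : ℕ} (hr : 1 ≤ r) (hI : 1 ≤ m / (r + 3)) (hNn : N + m + r + 1 < n)
    (hKN : 2 * m + (r + 3) ≤ N) {e : Sym2 (Site d)} (he : e ∈ edgesIn (zdGraph d) (box d n)) :
    (1 - p) * (bondPercolation (zdGraph d) p).real {ω | IsPivotal (armEvent (d := d) m n) e ω} ≤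
      max (Finset.univ.sup' (Finset.univ_nonempty_iff.2 (by
          obtain ⟨c, i, -, -⟩ := exists_eq_mk_of_mem_edgesIn he; exact ⟨i⟩))
            (fun i : Fin d => (bondPercolation (zdGraph d) p).real (AKN.edgeTwoArms i r)))
        (Real.sqrt (1 / (m / (r + 3) : ℕ) + (bondPercolation (zdGraph d) p).real (twoCross (d := d) (2 * m + (r + 3)) N))) := by
  obtain ⟨c, i, hcn, rfl⟩ := exists_eq_mk_of_mem_edgesIn he
  have heE : s(c, c + Pi.single i 1) ∈ (zdGraph d).edgeSet := (mem_edgesIn_iff.1 he).1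
  rw [← real_closedPivotal_eq (zdGraph d) (determinedBy_armEvent m n) p heE]
  have hIs : m / (r + 3) * (r + 3) ≤ m := Nat.div_mul_le_self m (r + 3)
  by_cases h1 : c ∈ box d (m + (r + 3) - 1)
  · -- near `Λ_m`
    exact (real_closedPivotal_inner_le p h1 hI hIs (by omega) hKN).trans (le_max_right _ _)
  by_cases h2 : ∃ j₁, (n : ℤ) - r ≤ |c j₁|
  · -- near `∂Λ_n`
    obtain ⟨j₁, hj₁⟩ := h2
    exact (real_closedPivotal_outer_le (i := i) p hj₁ hI hIs hNn hKN).trans (le_max_right _ _)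
  · -- far
    push Not at h2
    obtain ⟨n', rfl⟩ : ∃ n', n = n' + 1 := ⟨n - 1, by omega⟩
    obtain ⟨hball, hdisj⟩ := far_of_not_near (n' := n') h1 (fun j => by have := h2 j; push_cast at this ⊢; linarith)
    refine (real_closedPivotal_far_le p hr hball hdisj).trans ((Finset.le_sup' (fun i : Fin d => (bondPercolation (zdGraph d) p).real (AKN.edgeTwoArms i r)) (Finset.mem_univ i)).trans (le_max_left _ _))

/-! ## Asymptotic helpers -/

/-- Eventually `A ≤ n^ε`. [folklore] -/
theorem eventually_le_rpow (A : ℝ) {ε : ℝ} (hε : 0 < ε) : ∃ n₀ : ℕ, ∀ n : ℕ, n₀ ≤ n → A ≤ (n : ℝ) ^ ε := by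
  have h := ((tendsto_rpow_atTop hε).comp tendsto_natCast_atTop_atTop).eventually (Filter.eventually_ge_atTop A)
  obtain ⟨n₀, hn₀⟩ := Filter.eventually_atTop.1 h
  exact ⟨n₀, fun n hn => hn₀ n hn⟩

/-- Eventually `A (1 + log n) ≤ n^ε` (`A ≥ 0`). [folklore] -/
theorem eventually_mul_log_le_rpow {A ε : ℝ} (hA : 0 ≤ A) (hε : 0 < ε) :
    ∃ n₀ : ℕ, ∀ n : ℕ, n₀ ≤ n → A * (1 + Real.log n) ≤ (n : ℝ) ^ ε := by
  obtain ⟨n₀, hn₀⟩ := eventually_le_rpow (A + A * (2 / ε)) (half_pos hε)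
  refine ⟨max n₀ 1, fun n hn => ?_⟩
  have hn1 : (1 : ℝ) ≤ n := by exact_mod_cast (le_max_right _ _).trans hn
  have hn0 : (0 : ℝ) ≤ n := by linarith
  have hlog : Real.log n ≤ (n : ℝ) ^ (ε / 2) / (ε / 2) := Real.log_le_rpow_div hn0 (half_pos hε)
  have hpow1 : (1 : ℝ) ≤ (n : ℝ) ^ (ε / 2) := Real.one_le_rpow hn1 (half_pos hε).le
  have hkey := hn₀ n ((le_max_left _ _).trans hn)
  calc A * (1 + Real.log n) ≤ A * (1 + (n : ℝ) ^ (ε / 2) / (ε / 2)) := by gcongr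
    _ = A + A * (2 / ε) * (n : ℝ) ^ (ε / 2) := by field_simp
    _ ≤ (A + A * (2 / ε)) * (n : ℝ) ^ (ε / 2) := by
        have : 0 ≤ A * (2 / ε) := by positivity
        nlinarith
    _ ≤ (n : ℝ) ^ (ε / 2) * (n : ℝ) ^ (ε / 2) := mul_le_mul_of_nonneg_right hkey (by positivity)
    _ = (n : ℝ) ^ ε := by rw [← Real.rpow_add (by linarith)]; ring_nf

/-! ## Lemma 6: the arithmetic of the three bounds -/

/-- Far-case arithmetic: `κ(1 + log r)/√r ≤ δ x^{−β/16}` once `(κ√2/δ)(1 + log x) ≤ x^{β/16}`,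
`x^{β/4} − 1 ≤ r ≤ x^{β/4}` and `x^{β/4} ≥ 4`. [folklore] -/
theorem far_arith {κ δ β x r : ℝ} (hκ0 : 0 < κ) (hδ0 : 0 < δ) (hx1 : 1 ≤ x) (hβ1 : β ≤ 1)
    (T1 : 4 ≤ x ^ (β / 4)) (T5 : κ * Real.sqrt 2 / δ * (1 + Real.log x) ≤ x ^ (β / 16))
    (hr_le : r ≤ x ^ (β / 4)) (hr_ge : x ^ (β / 4) - 1 ≤ r) :
    κ * (1 + Real.log r) / Real.sqrt r ≤ δ * x ^ (-(β / 16)) := by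
  have hx0 : 0 < x := by linarith
  have hr2 : 2 ≤ r := by linarith
  have hr0 : 0 < r := by linarith
  have hlx : 0 ≤ Real.log x := Real.log_nonneg hx1
  have hrx : r ≤ x := hr_le.trans ((Real.rpow_le_rpow_of_exponent_le hx1 (by linarith : β / 4 ≤ 1)).trans (Real.rpow_one x).le)
  have hlog : Real.log r ≤ Real.log x := Real.log_le_log hr0 hrx
  have hsqrt : Real.sqrt (x ^ (β / 4) / 2) ≤ Real.sqrt r := Real.sqrt_le_sqrt (by linarith)
  have hsx : Real.sqrt (x ^ (β / 4) / 2) = x ^ (β / 8) / Real.sqrt 2 := by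
    rw [Real.sqrt_div (by positivity), Real.sqrt_eq_rpow, ← Real.rpow_mul hx0.le]; ring_nf
  rw [hsx] at hsqrt
  have hx8 : 0 < x ^ (β / 8) := by positivity
  have hsr0 : 0 < Real.sqrt r := Real.sqrt_pos.2 hr0
  have hinv : 1 / Real.sqrt r ≤ Real.sqrt 2 / x ^ (β / 8) := by
    have := one_div_le_one_div_of_le (by positivity) hsqrt
    rwa [one_div_div] at this
  have hnum : 0 ≤ κ * (1 + Real.log x) := mul_nonneg hκ0.le (by linarith)
  have h1 : κ * (1 + Real.log r) / Real.sqrt r ≤ κ * (1 + Real.log x) * (Real.sqrt 2 / x ^ (β / 8)) := by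
    calc κ * (1 + Real.log r) / Real.sqrt r ≤ κ * (1 + Real.log x) / Real.sqrt r :=
          div_le_div_of_nonneg_right (by gcongr) hsr0.le
      _ = κ * (1 + Real.log x) * (1 / Real.sqrt r) := by ring
      _ ≤ κ * (1 + Real.log x) * (Real.sqrt 2 / x ^ (β / 8)) := mul_le_mul_of_nonneg_left hinv hnum
  refine h1.trans ?_
  have h2 : κ * (1 + Real.log x) * Real.sqrt 2 ≤ δ * x ^ (β / 16) := by
    have := T5
    rw [div_mul_eq_mul_div, div_le_iff₀ hδ0] at this
    linarith
  have h3 : x ^ (β / 16) / x ^ (β / 8) = x ^ (-(β / 16)) := by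
    rw [← Real.rpow_sub hx0]; ring_nf
  calc κ * (1 + Real.log x) * (Real.sqrt 2 / x ^ (β / 8)) = κ * (1 + Real.log x) * Real.sqrt 2 / x ^ (β / 8) := by ring
    _ ≤ δ * x ^ (β / 16) / x ^ (β / 8) := div_le_div_of_nonneg_right h2 hx8.le
    _ = δ * x ^ (-(β / 16)) := by rw [mul_div_assoc, h3]

/-- Near-case arithmetic: `√(1/I + Q) ≤ δ x^{−β/16}` once `I ≥ x^{3β/4}/8`, `Q ≤ 4x^{−3β/4}` and
`√12/δ ≤ x^{5β/16}`. [folklore] -/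
theorem near_arith {δ β x I Q : ℝ} (hδ0 : 0 < δ) (hx0 : 0 < x) (hI0 : 0 < I)
    (hI : x ^ (3 * β / 4) / 8 ≤ I) (hQ : Q ≤ 4 * x ^ (-(3 * β / 4))) (T6 : Real.sqrt 12 / δ ≤ x ^ (5 * β / 16)) :
    Real.sqrt (1 / I + Q) ≤ δ * x ^ (-(β / 16)) := by
  have hIinv : 1 / I ≤ 8 * x ^ (-(3 * β / 4)) := by
    rw [Real.rpow_neg hx0.le, ← div_eq_mul_inv, div_le_div_iff₀ hI0 (by positivity)]
    linarith
  have hsum : 1 / I + Q ≤ 12 * x ^ (-(3 * β / 4)) := by linarith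
  refine (Real.sqrt_le_sqrt hsum).trans ?_
  have hsq : Real.sqrt (12 * x ^ (-(3 * β / 4))) = Real.sqrt 12 * x ^ (-(3 * β / 8)) := by
    rw [Real.sqrt_mul (by norm_num), Real.sqrt_eq_rpow (x ^ (-(3 * β / 4))), ← Real.rpow_mul hx0.le]; ring_nf
  rw [hsq]
  have h2 : Real.sqrt 12 ≤ δ * x ^ (5 * β / 16) := by rwa [div_le_iff₀' hδ0] at T6
  have h3 : x ^ (5 * β / 16) * x ^ (-(3 * β / 8)) = x ^ (-(β / 16)) := by rw [← Real.rpow_add hx0]; ring_nf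
  have h4 : 0 ≤ x ^ (-(3 * β / 8)) := by positivity
  calc Real.sqrt 12 * x ^ (-(3 * β / 8)) ≤ δ * x ^ (5 * β / 16) * x ^ (-(3 * β / 8)) := mul_le_mul_of_nonneg_right h2 h4
    _ = δ * x ^ (-(β / 16)) := by rw [mul_assoc, h3]

/-- Prop-1 arithmetic: `N^{−α} ≤ 4 x^{−3β/4}` for `N ≥ x/4`, `3β/4 ≤ α < 1`, `x ≥ 1`. [folklore] -/
theorem prop1_arith {α β x N : ℝ} (hx1 : 1 ≤ x) (hNx : x / 4 ≤ N) (hβα : 3 * β / 4 ≤ α) (hα1 : α < 1) (hα0 : 0 ≤ α) :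
    N ^ (-α) ≤ 4 * x ^ (-(3 * β / 4)) := by
  have hx0 : 0 < x := by linarith
  have h1 : N ^ (-α) ≤ (x / 4) ^ (-α) := Real.rpow_le_rpow_of_nonpos (by positivity) hNx (by linarith)
  have h2 : (x / 4) ^ (-α) = 4 ^ α * x ^ (-α) := by
    rw [Real.div_rpow hx0.le (by norm_num), Real.rpow_neg (by norm_num : (0:ℝ) ≤ 4), div_eq_mul_inv, inv_inv, mul_comm]
  have h3 : (4 : ℝ) ^ α ≤ 4 := by
    calc (4 : ℝ) ^ α ≤ 4 ^ (1 : ℝ) := Real.rpow_le_rpow_of_exponent_le (by norm_num) hα1.le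
      _ = 4 := Real.rpow_one 4
  have h4 : x ^ (-α) ≤ x ^ (-(3 * β / 4)) := Real.rpow_le_rpow_of_exponent_le hx1 (by linarith)
  have h5 : 0 ≤ x ^ (-α) := by positivity
  have h6 : 0 ≤ (4 : ℝ) ^ α := by positivity
  calc N ^ (-α) ≤ 4 ^ α * x ^ (-α) := h1.trans h2.le
    _ ≤ 4 * x ^ (-α) := mul_le_mul_of_nonneg_right h3 h5
    _ ≤ 4 * x ^ (-(3 * β / 4)) := by linarith

/-- Integer-division arithmetic: `I = m / s ≥ x^{3β/4}/8` when `m ≥ x^β − 1`, `s ≤ 2x^{β/4}`,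
`x^β = x^{β/4} x^{3β/4}`, `x^{β/4} ≥ 4`, `x^{3β/4} ≥ 8`. [folklore] -/
theorem div_arith {β x : ℝ} {m s : ℕ} (hs : 0 < s) (hm_ge : x ^ β - 1 ≤ m) (hs_le : (s : ℝ) ≤ 2 * x ^ (β / 4))
    (hxβ : x ^ β = x ^ (β / 4) * x ^ (3 * β / 4)) (T1 : 4 ≤ x ^ (β / 4)) (T2 : 8 ≤ x ^ (3 * β / 4)) :
    x ^ (3 * β / 4) / 8 ≤ ((m / s : ℕ) : ℝ) := by
  have hs0 : (0 : ℝ) < s := by exact_mod_cast hs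
  have hdiv : ((m : ℝ) - s) / s ≤ ((m / s : ℕ) : ℝ) := by
    have h := Nat.div_add_mod m s
    have hmod := Nat.mod_lt m hs
    have h' : (s : ℝ) * ((m / s : ℕ) : ℝ) + ((m % s : ℕ) : ℝ) = m := by exact_mod_cast h
    have hmod' : ((m % s : ℕ) : ℝ) < s := by exact_mod_cast hmod
    rw [div_le_iff₀ hs0]
    nlinarith
  refine le_trans ?_ hdiv
  rw [div_le_div_iff₀ (by norm_num) hs0]
  have hx4pos : 0 < x ^ (β / 4) := by linarith
  have h8 : 8 * x ^ (β / 4) ≤ x ^ β := by rw [hxβ]; nlinarith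
  have h2 : x ^ β / 2 ≤ (m : ℝ) - s := by linarith
  have h3 : x ^ (3 * β / 4) * (s : ℝ) ≤ x ^ (3 * β / 4) * (2 * x ^ (β / 4)) := mul_le_mul_of_nonneg_left hs_le (by linarith)
  have h4 : x ^ (3 * β / 4) * (2 * x ^ (β / 4)) = 2 * x ^ β := by rw [hxβ]; ring
  have h5 : 0 ≤ x ^ β := by linarith
  linarith

/-! ## Lemma 6 -/

/-- **DKT 2020, Lemma 6 (bond percolation on `ℤ^d`, `d ≥ 1`)**: for `0 < β < α`, where `α` is an
exponent for which Proposition 1 holds on `[δ', 1−δ']` (`δ' ≤ min(δ, ½)`), there is `n₆` such that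
for `n ≥ n₆`, `p ∈ [δ, 1−δ]` and every edge `e` inside `Λ_n`,
`P_p(e pivotal for armEvent ⌊n^β⌋ n) ≤ n^{−β/16}` (printed: "`≤ m^{−α/4}`"; any polynomial decay
suffices downstream). Proof as printed (three cases), with the AKN two-arms bound in the far case.
[cite: DuminilcopinKozmaTassion2020, Lemma 6] -/
theorem lemma6 (hd : 1 ≤ d) {δ δ' β α : ℝ} (hδ'0 : 0 < δ') (hδ'h : δ' ≤ 1 / 2) (hδ'δ : δ' ≤ δ)
    (hβ0 : 0 < β) (hβα : β < α) (hα1 : α < 1) {n₁ : ℕ}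
    (hP1 : ∀ n : ℕ, n₁ ≤ n → ∀ p : unitInterval, δ' ≤ (p : ℝ) → (p : ℝ) ≤ 1 - δ' →
      (bondPercolation (zdGraph d) p).real (uniqZone (d := d) ⌊(n : ℝ) ^ α⌋₊ n)ᶜ ≤ (n : ℝ) ^ (-α)) :
    ∃ n₆ : ℕ, ∀ n : ℕ, n₆ ≤ n → ∀ p : unitInterval, δ ≤ (p : ℝ) → (p : ℝ) ≤ 1 - δ →
      ∀ e ∈ edgesIn (zdGraph d) (box d n),
        (bondPercolation (zdGraph d) p).real {ω | IsPivotal (armEvent (d := d) ⌊(n : ℝ) ^ β⌋₊ n) e ω} ≤ (n : ℝ) ^ (-(β / 16)) := by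
  have hδ0 : 0 < δ := hδ'0.trans_le hδ'δ
  obtain ⟨κ, hκ0, hκ⟩ := AKN.exists_real_edgeTwoArms_le hd hδ'0 hδ'h
  -- thresholds
  obtain ⟨t₁, ht₁⟩ := eventually_le_rpow (4 : ℝ) (by positivity : 0 < β / 4)
  obtain ⟨t₂, ht₂⟩ := eventually_le_rpow (8 : ℝ) (by positivity : 0 < 3 * β / 4)
  obtain ⟨t₃, ht₃⟩ := eventually_le_rpow (7 : ℝ) (by linarith : 0 < 1 - β)
  obtain ⟨t₄, ht₄⟩ := eventually_le_rpow (16 : ℝ) (by linarith : 0 < α - β)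
  obtain ⟨t₅, ht₅⟩ := eventually_mul_log_le_rpow (by positivity : 0 ≤ κ * Real.sqrt 2 / δ) (by positivity : 0 < β / 16)
  obtain ⟨t₆, ht₆⟩ := eventually_le_rpow (Real.sqrt 12 / δ) (by positivity : 0 < 5 * β / 16)
  refine ⟨max (max (max t₁ t₂) (max t₃ t₄)) (max (max t₅ t₆) (2 * n₁ + 2)), ?_⟩
  intro n hn p hpδ hp1δ e he
  simp only [max_le_iff] at hn
  obtain ⟨⟨⟨hn₁, hn₂⟩, ⟨hn₃, hn₄⟩⟩, ⟨⟨hn₅, hn₆⟩, hnn₁⟩⟩ := hn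
  -- the real variable `x = n` and its powers
  obtain ⟨x, hx⟩ : ∃ x : ℝ, x = n := ⟨_, rfl⟩
  have hx2 : 2 ≤ x := by rw [hx]; exact_mod_cast (by omega : 2 ≤ n)
  have hx1 : 1 ≤ x := by linarith
  have hx0 : 0 < x := by linarith
  have T1 : 4 ≤ x ^ (β / 4) := hx ▸ ht₁ n hn₁
  have T2 : 8 ≤ x ^ (3 * β / 4) := hx ▸ ht₂ n hn₂
  have T3 : 7 ≤ x ^ (1 - β) := hx ▸ ht₃ n hn₃
  have T4 : 16 ≤ x ^ (α - β) := hx ▸ ht₄ n hn₄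
  have T5 : κ * Real.sqrt 2 / δ * (1 + Real.log x) ≤ x ^ (β / 16) := hx ▸ ht₅ n hn₅
  have T6 : Real.sqrt 12 / δ ≤ x ^ (5 * β / 16) := hx ▸ ht₆ n hn₆
  have hpow_mono : ∀ {a b : ℝ}, a ≤ b → x ^ a ≤ x ^ b := fun hab => Real.rpow_le_rpow_of_exponent_le hx1 hab
  have hxβ : x ^ β = x ^ (β / 4) * x ^ (3 * β / 4) := by rw [← Real.rpow_add hx0]; ring_nf
  have hx4pos : 0 < x ^ (β / 4) := by positivity
  have hx4β : x ^ (β / 4) ≤ x ^ β := hpow_mono (by linarith)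
  have hxβ1 : x = x ^ β * x ^ (1 - β) := by rw [← Real.rpow_add hx0]; ring_nf; exact (Real.rpow_one x).symm
  have hxβx : 7 * x ^ β ≤ x := by
    have h0 : 0 ≤ x ^ β := by positivity
    calc 7 * x ^ β ≤ x ^ β * x ^ (1 - β) := by nlinarith
      _ = x := hxβ1.symm
  have hxα : x ^ α = x ^ β * x ^ (α - β) := by rw [← Real.rpow_add hx0]; ring_nf
  have hxβα : 16 * x ^ β ≤ x ^ α := by
    have h0 : 0 ≤ x ^ β := by positivity
    rw [hxα]; nlinarith
  -- the integer parameters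
  obtain ⟨m, hm⟩ : ∃ m : ℕ, m = ⌊x ^ β⌋₊ := ⟨_, rfl⟩
  obtain ⟨r, hr⟩ : ∃ r : ℕ, r = ⌊x ^ (β / 4)⌋₊ := ⟨_, rfl⟩
  have hmn : ⌊(n : ℝ) ^ β⌋₊ = m := by rw [hm, hx]
  rw [hmn, ← hx]
  have hr_le : (r : ℝ) ≤ x ^ (β / 4) := by rw [hr]; exact Nat.floor_le (by positivity)
  have hr_ge : x ^ (β / 4) - 1 ≤ r := by
    have := Nat.lt_floor_add_one (x ^ (β / 4))
    rw [hr]; linarith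
  have hm_le : (m : ℝ) ≤ x ^ β := by rw [hm]; exact Nat.floor_le (by positivity)
  have hm_ge : x ^ β - 1 ≤ m := by
    have := Nat.lt_floor_add_one (x ^ β)
    rw [hm]; linarith
  have hr1 : 1 ≤ r := by
    have : (1 : ℝ) ≤ r := by linarith
    exact_mod_cast this
  have hs_le : ((r + 3 : ℕ) : ℝ) ≤ 2 * x ^ (β / 4) := by push_cast; linarith
  have hsm : r + 3 ≤ m := by
    have : (r : ℝ) + 3 ≤ m := by nlinarith
    exact_mod_cast this
  have hI : 1 ≤ m / (r + 3) := (Nat.one_le_div_iff (by omega)).2 hsm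
  obtain ⟨N, hN⟩ : ∃ N : ℕ, N = n / 2 := ⟨_, rfl⟩
  have hN2 : 2 * N ≤ n := by rw [hN]; exact Nat.mul_div_le n 2
  have hN2' : n ≤ 2 * N + 1 := by rw [hN]; omega
  have hNx : x / 4 ≤ N := by
    have : (n : ℝ) ≤ 2 * N + 1 := by exact_mod_cast hN2'
    rw [hx]; linarith
  have hNn₁ : n₁ ≤ N := by rw [hN]; omega
  have hN1 : (1 : ℝ) ≤ N := by
    have : (1 : ℝ) ≤ ((N : ℕ) : ℝ) := by exact_mod_cast (by rw [hN]; omega : 1 ≤ N)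
    exact this
  -- R4: `N + m + r + 1 < n`
  have hR4 : N + m + r + 1 < n := by
    have h : (N : ℝ) + m + r + 1 < n := by
      have : (2 : ℝ) * N ≤ n := by exact_mod_cast hN2
      have h1 : (m : ℝ) + r + 1 ≤ 3 * x ^ β := by linarith
      rw [← hx] at this ⊢
      linarith
    exact_mod_cast h
  -- R5: `2m + (r+3) ≤ ⌊N^α⌋₊ ≤ N`
  have hNα : x ^ α / 4 ≤ (N : ℝ) ^ α := by
    have h1 : (x / 4) ^ α ≤ (N : ℝ) ^ α := Real.rpow_le_rpow (by positivity) hNx (by linarith)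
    have h2 : (x / 4) ^ α = x ^ α / 4 ^ α := Real.div_rpow hx0.le (by norm_num) α
    have h3 : (4 : ℝ) ^ α ≤ 4 := by
      calc (4 : ℝ) ^ α ≤ 4 ^ (1 : ℝ) := Real.rpow_le_rpow_of_exponent_le (by norm_num) hα1.le
        _ = 4 := Real.rpow_one 4
    have h4 : x ^ α / 4 ≤ x ^ α / 4 ^ α := div_le_div_of_nonneg_left (by positivity) (by positivity) h3
    linarith
  have hK_real : ((2 * m + (r + 3) : ℕ) : ℝ) ≤ (N : ℝ) ^ α := by push_cast; linarith
  have hR5 : 2 * m + (r + 3) ≤ ⌊(N : ℝ) ^ α⌋₊ := Nat.le_floor hK_real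
  have hfloorN : ⌊(N : ℝ) ^ α⌋₊ ≤ N := by
    refine Nat.floor_le_of_le ?_
    calc (N : ℝ) ^ α ≤ (N : ℝ) ^ (1 : ℝ) := Real.rpow_le_rpow_of_exponent_le hN1 hα1.le
      _ = N := Real.rpow_one _
  have hKN : 2 * m + (r + 3) ≤ N := hR5.trans hfloorN
  -- parameters for the probability bounds
  have hp1 : (p : ℝ) < 1 := by linarith only [hp1δ, hδ0]
  have hpδ' : δ' ≤ (p : ℝ) := hδ'δ.trans hpδ
  have hp1δ' : (p : ℝ) ≤ 1 - δ' := by linarith only [hp1δ, hδ'δ]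
  -- far term
  have hfar : ∀ i : Fin d, (bondPercolation (zdGraph d) p).real (AKN.edgeTwoArms i r) ≤ δ * x ^ (-(β / 16)) :=
    fun i => (hκ p hpδ' hp1δ' i r hr1).trans
      (far_arith hκ0 hδ0 hx1 (by linarith only [hβα, hα1]) T1 T5 hr_le hr_ge)
  -- near term
  have hQ : (bondPercolation (zdGraph d) p).real (twoCross (d := d) (2 * m + (r + 3)) N) ≤ 4 * x ^ (-(3 * β / 4)) := by
    refine (real_twoCross_le p hKN).trans ?_
    have hanti : (uniqZone (d := d) (2 * m + (r + 3)) N)ᶜ ⊆ (uniqZone (d := d) ⌊(N : ℝ) ^ α⌋₊ N)ᶜ :=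
      Set.compl_subset_compl.2 (uniqZone_anti hR5)
    exact (measureReal_mono hanti).trans ((hP1 N hNn₁ p hpδ' hp1δ').trans
      (prop1_arith hx1 hNx (by linarith only [hβα, hβ0]) hα1 (by linarith only [hβα, hβ0])))
  have hnear : Real.sqrt (1 / (m / (r + 3) : ℕ) + (bondPercolation (zdGraph d) p).real (twoCross (d := d) (2 * m + (r + 3)) N)) ≤
      δ * x ^ (-(β / 16)) :=
    near_arith hδ0 hx0 (by exact_mod_cast hI) (div_arith (by omega) hm_ge hs_le hxβ T1 T2) hQ T6
  -- conclude
  have hmax : max (Finset.univ.sup' (Finset.univ_nonempty_iff.2 (by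
          obtain ⟨c, i, -, -⟩ := exists_eq_mk_of_mem_edgesIn he; exact ⟨i⟩))
            (fun i : Fin d => (bondPercolation (zdGraph d) p).real (AKN.edgeTwoArms i r)))
        (Real.sqrt (1 / (m / (r + 3) : ℕ) + (bondPercolation (zdGraph d) p).real (twoCross (d := d) (2 * m + (r + 3)) N))) ≤
      δ * x ^ (-(β / 16)) := max_le (Finset.sup'_le _ _ fun i _ => hfar i) hnear
  have hfin := (lemma6_at p hr1 hI hR4 hKN he).trans hmax
  clear hmax
  have h1p : δ ≤ 1 - (p : ℝ) := by linarith only [hp1δ]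
  have hxpow : 0 ≤ x ^ (-(β / 16)) := by positivity
  by_contra hcon
  push Not at hcon
  have : δ * x ^ (-(β / 16)) < (1 - (p : ℝ)) * (bondPercolation (zdGraph d) p).real {ω | IsPivotal (armEvent (d := d) m n) e ω} := by
    calc δ * x ^ (-(β / 16)) ≤ (1 - (p : ℝ)) * x ^ (-(β / 16)) := mul_le_mul_of_nonneg_right h1p hxpow
      _ < (1 - (p : ℝ)) * _ := mul_lt_mul_of_pos_left hcon (by linarith only [hp1])
  linarith only [this, hfin]

/-! ## Proposition 5 for every `β ∈ (0,1)` -/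

/-- **DKT 2020, Proposition 5 (bond percolation, the tree's scales), for every `β ∈ (0,1)`**: from
Lemma 6 (`β < α`) via `prop5_of_lemma6`, and by monotonicity of `Λ_{⌊n^β⌋}` in `β` for `β ≥ α`
("We may assume without loss of generality that `β < α`").
[cite: DuminilcopinKozmaTassion2020, Proposition 5] -/
theorem prop5 : ∀ d : ℕ, 3 ≤ d → ∀ δ : ℝ, 0 < δ → ∀ β : ℝ, 0 < β → β < 1 → ∃ C : ℝ, 0 < C ∧ ∃ n₅ : ℕ,
      ∀ n : ℕ, n₅ ≤ n → ∀ p q : unitInterval, δ ≤ (p : ℝ) → (q : ℝ) ≤ 1 - δ →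
        (∀ S ∈ DCT16.originSets d n, Real.exp (-1) ≤ DCT16.phi p S) →
        (p : ℝ) + C / Real.sqrt (Real.log n) ≤ q →
        1 - Real.exp (-Real.sqrt (Real.log n)) ≤
          (bondPercolation (zdGraph d) q).real
            (linkEvent (box d ⌊(n : ℝ) ^ β⌋₊) (innerBoundary (zdGraph d) (box d n)) n) := by
  intro d hd δ hδ
  have hd1 : 1 ≤ d := by omega
  -- Proposition 1 on `[δ', 1 − δ']`, `δ' = min δ ½`
  obtain ⟨δ', hδ'⟩ : ∃ δ' : ℝ, δ' = min δ (1 / 2) := ⟨_, rfl⟩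
  have hδ'0 : 0 < δ' := by rw [hδ']; exact lt_min hδ (by norm_num)
  have hδ'h : δ' ≤ 1 / 2 := by rw [hδ']; exact min_le_right _ _
  have hδ'δ : δ' ≤ δ := by rw [hδ']; exact min_le_left _ _
  obtain ⟨α, hα0, hα1, n₁, hP1⟩ := AKN.dkt_prop1 (d := d) hd1 hδ'0
  -- the case `β < α`
  have hsmall : ∀ β : ℝ, 0 < β → β < α → ∃ C : ℝ, 0 < C ∧ ∃ n₅ : ℕ,
      ∀ n : ℕ, n₅ ≤ n → ∀ p q : unitInterval, δ ≤ (p : ℝ) → (q : ℝ) ≤ 1 - δ →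
        (∀ S ∈ DCT16.originSets d n, Real.exp (-1) ≤ DCT16.phi p S) →
        (p : ℝ) + C / Real.sqrt (Real.log n) ≤ q →
        1 - Real.exp (-Real.sqrt (Real.log n)) ≤
          (bondPercolation (zdGraph d) q).real
            (linkEvent (box d ⌊(n : ℝ) ^ β⌋₊) (innerBoundary (zdGraph d) (box d n)) n) := by
    intro β hβ0 hβα
    obtain ⟨n₆, h6⟩ := lemma6 hd1 hδ'0 hδ'h hδ'δ hβ0 hβα hα1 hP1
    exact prop5_of_lemma6 hδ (hβα.trans hα1) ⟨β / 16, by positivity, n₆, h6⟩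
  intro β hβ0 hβ1
  by_cases hβα : β < α
  · exact hsmall β hβ0 hβα
  · -- `β ≥ α`: use `β₀ = α/2` and monotonicity
    push Not at hβα
    obtain ⟨C, hC, n₅, h5⟩ := hsmall (α / 2) (by positivity) (by linarith)
    refine ⟨C, hC, max n₅ 1, fun n hn p q hp hq hφ hwin => ?_⟩
    have hn5 : n₅ ≤ n := (le_max_left _ _).trans hn
    have hn1 : (1 : ℝ) ≤ n := by exact_mod_cast (le_max_right _ _).trans hn
    refine (h5 n hn5 p q hp hq hφ hwin).trans (measureReal_mono (linkEvent_mono_left (box_mono d (Nat.floor_le_floor ?_)) _ n))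
    exact Real.rpow_le_rpow_of_exponent_le hn1 (by linarith)

end DKT20

/-- **Duminil-Copin–Kozma–Tassion 2020, Theorem 2 (subcritical case), discharged**: for `d ≥ 3`
there is `C > 0` with `ξ_p ≤ exp(C/(p_c − p)²)` for all `0 < p < p_c`, in the tree's rate form.
Assembled from Proposition 4 (`DKT20.prop4'`), Proposition 5 (`DKT20.prop5`: Talagrand's
inequality via the log-Sobolev route, Russo's formula, Lemma 6), Proposition 1
(`AKN.dkt_prop1`: Cerf 2015 with the Aizenman–Kesten–Newman bound) and Theorem 7
(`DKT20.thm7_criticalProb_le`, quantitative Grimmett–Marstrand) through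
`DKT20.thm2_subcritical_of_prop5`. [cite: DuminilcopinKozmaTassion2020, Theorem 2] -/
theorem DuminilcopinKozmaTassion2020_thm2_subcritical_holds : DuminilcopinKozmaTassion2020_thm2_subcritical :=
  DKT20.thm2_subcritical_of_prop5 DKT20.prop5

end Literature.Probability.Percolation

end
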